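import Summits.CriticalPhenomena.PercolationContinuityZ3.Theorems.SahiMasterFamilyStructCanonical

/-!
# Structure theory of `Z_k`, faces: GOOD CHAINS RESTRICT TO FACES, FRAMES AND ANNIHILATORS COMMUTE WITH SECTIONS

Unit `prim-master-conj` (crux anchor stmt-CriticalPhenomena-4575), gen 9.  Seat document HOME/prim-master-conj/TIGHTNESS.md §4.8 (FC).

Gen 7's `SahiMasterFamilyMinorClosed` shows that the zero-flag class `Z_k` is closed under sections (`secAt e b`).  For the tightness
programme ((EQI-k) at every order ⟸ "terminal families are principal-cap", `SahiMasterFamilyTerminalTight`) one needs the finer statement at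
the level of the structure theory (`SahiMasterFamilyStructDefs`/`…Frames`/`…Canonical`, gen 6): sectioning a coordinate `e` (either value `b`)
maps every GOOD CHAIN of a family of increasing events to a good chain of the sectioned family IN THE SAME ORDER, and the frames (hence the
annihilators, and the canonical frames) of the sectioned chain are the sections of the frames — provided the sectioned members are non-empty
(automatic for `b = true`; for `b = false` it says that `e` lies in no member's core).

* `hull_secAt_of_notMem` — `hull S (A^{e←b}) = (hull S A)^{e←b}` for `e ∉ S`;
* `goodChain_secAt_aux` — the induction on the length (frames, frame supports, safety of the sectioned annihilators: the sub-families to be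
  shown structured are sections of structured sub-families, shorter chains);
* **`goodChain_secAt`**, **`frameIn_secAt`**, `frameSupp_secAt_subset`, **`structured_secAt`**, **`cframe_secAt`** (canonical frames commute with
  sections).
The key step (`secAt_hull_frameSupp_eq`): for the head `v` of a good chain `v :: l`, `(hull S' (U v))^{e←b} = (hull S (U v))^{e←b}` where `S`, `S'`
are the frame supports of `l` for the family and for its sections — by T″ (`mem_of_frameFail_card_le_one`): the configuration `forceAt e b ω ∪ S'`
lies in every frame of `v :: l`.  Census (seat code-g9/frames.py, chains.py): every structured family of `≤ 4` events on `≤ 4` coordinates, both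
faces, every good order — 0 exceptions.  No conjecture asserted; axioms standard. [this work]
-/

noncomputable section

open scoped Classical

namespace Summit.CriticalPhenomena.PercolationContinuityZ3.Theorems

open Finset Function
open Literature.Probability.LatticeModels.Kahn2022 (Affects)

variable {ι : Type*} [Fintype ι] {κ : Type*} (U : κ → Set (Set ι)) (e : ι) (b : Bool)

/-! ### Sections and hulls -/

omit [Fintype ι] in
/-- Forcing `e` commutes with turning on a set of coordinates not containing `e`. [folklore] -/
theorem forceAt_union_of_notMem {S : Set ι} (he : e ∉ S) (ω : Set ι) : forceAt e b (ω ∪ S) = forceAt e b ω ∪ S := by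
  cases b
  · simp only [forceAt, cond_false]
    rw [Set.union_sdiff_distrib, Set.sdiff_singleton_eq_self he]
  · simp only [forceAt, cond_true, Set.insert_union]

omit [Fintype ι] in
/-- **`hull S (A^{e←b}) = (hull S A)^{e←b}` for `e ∉ S`.** [this work] -/
theorem hull_secAt_of_notMem {S : Set ι} (he : e ∉ S) (A : Set (Set ι)) : hull S (secAt e b A) = secAt e b (hull S A) := by
  ext ω
  rw [mem_hull, mem_secAt, mem_secAt, mem_hull, forceAt_union_of_notMem e b he]

omit [Fintype ι] in
/-- Member failures of a section are member failures of the forced configuration. [this work] -/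
theorem failSet_secAt (W : Finset κ) (φ : Set ι) :
    failSet (fun k => secAt e b (U k)) W φ = failSet U W (forceAt e b φ) := by
  ext w
  simp only [mem_failSet, mem_secAt]

/-! ### The induction -/

/-- **Good chains restrict to faces** (induction on the length).  For increasing events whose `e ← b` sections are all non-empty: every good
chain `l` of `U` is a good chain of the sectioned family, the frames of the sectioned chain are the sections of the frames, its frame support is
contained in that of `l` and misses `e`. [this work] -/
theorem goodChain_secAt_aux (hU : ∀ k, IsUpperSet (U k)) (hne : ∀ k, (secAt e b (U k)).Nonempty) :
    ∀ (n : ℕ) {l : List κ}, l.length ≤ n → GoodChain U l →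
      GoodChain (fun k => secAt e b (U k)) l ∧
        (∀ w ∈ l, frameIn (fun k => secAt e b (U k)) l w = secAt e b (frameIn U l w)) ∧
        frameSupp (fun k => secAt e b (U k)) l ⊆ frameSupp U l ∧ e ∉ frameSupp (fun k => secAt e b (U k)) l
  | 0, l, hn, _ => by
    have : l = [] := List.eq_nil_of_length_eq_zero (Nat.le_zero.1 hn)
    subst this
    refine ⟨by simp, fun w hw => absurd hw List.not_mem_nil, ?_, ?_⟩ <;> simp [frameSupp]
  | n + 1, [], _, _ => by
    refine ⟨by simp, fun w hw => absurd hw List.not_mem_nil, ?_, ?_⟩ <;> simp [frameSupp]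
  | n + 1, v :: l, hn, hl => by
    set U' : κ → Set (Set ι) := fun k => secAt e b (U k) with hU'def
    have hU' : ∀ k, IsUpperSet (U' k) := fun k => isUpperSet_secAt e b (hU k)
    obtain ⟨hl0, hv, hs⟩ := (goodChain_cons U).1 hl
    have hlen : l.length ≤ n := by simp only [List.length_cons] at hn; omega
    obtain ⟨ih1, ih2, ih3, ih4⟩ := goodChain_secAt_aux hU hne n hlen hl0
    -- the frame supports of the tail
    set S := frameSupp U l with hSdef
    set S' := frameSupp U' l with hS'def
    -- KEY: the sectioned hull over `S'` is the sectioned hull over `S`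
    have key : hull S' (U' v) = secAt e b (hull S (U v)) := by
      rw [hU'def, hull_secAt_of_notMem e b ih4]
      ext ω
      rw [mem_secAt, mem_secAt, mem_hull, mem_hull]
      constructor
      · intro h; exact hU v (Set.union_subset_union_right _ ih3) h
      · intro h
        -- `π := forceAt e b ω ∪ S'` lies in every frame of `v :: l`; by T″ it lies in `U v`
        set π := forceAt e b ω ∪ S' with hπ
        have hπv : π ∈ frameIn U (v :: l) v := by
          rw [frameIn_cons_self, mem_hull, hπ, Set.union_assoc, Set.union_eq_right.2 ih3]
          exact h
        have hπw : ∀ u ∈ (v :: l), u ≠ v → π ∈ frameIn U (v :: l) u := by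
          intro u hu huv
          have hul : u ∈ l := List.mem_of_ne_of_mem huv hu
          rw [frameIn_cons_of_ne U huv]
          -- the sectioned frame of `u` is determined by coordinates inside `S'`
          have hA' : ω ∪ S' ∈ frameIn U' l u := by
            refine mem_of_esupp_subset (isUpperSet_frameIn U' hU' l u) (frameIn_nonempty U' hU' hne l u) ?_
            exact (esupp_frameIn_subset_frameSupp U' hul).trans Set.subset_union_right
          rw [ih2 u hul, mem_secAt, forceAt_union_of_notMem e b ih4] at hA'
          exact hA'
        have hcard : (frameFail U (v :: l) π).card ≤ 1 := frameFail_card_le_one_of_forall U v hπw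
        exact mem_of_frameFail_card_le_one U hl hU hcard List.mem_cons_self hπv
    refine ⟨?_, ?_, ?_, ?_⟩
    · -- good chain: safety of the sectioned annihilator
      refine (goodChain_cons U').2 ⟨ih1, hv, ?_⟩
      intro φ hφ
      rw [← hS'def, key, Set.mem_sdiff, mem_secAt, hU'def, mem_secAt] at hφ
      have hsafe := hs ⟨(mem_hull).2 ((mem_hull).1 hφ.1), hφ.2⟩
      rw [mem_safe] at hsafe ⊢
      refine ⟨?_, fun R hR hRl => ?_⟩
      · rw [failSet_secAt]; exact hsafe.1
      · rw [failSet_secAt] at hR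
        obtain ⟨lR, hlR, hnd, hlenR, hgood⟩ := Structured.exists_chain U (hsafe.2 R hR hRl)
        have hRcard : R.card ≤ n :=
          ((card_le_card hRl).trans (List.toFinset_card_le l)).trans hlen
        exact ⟨lR, hlR, (goodChain_secAt_aux hU hne n (hlenR ▸ hRcard) hgood).1⟩
    · -- frames
      intro w hw
      by_cases hwv : w = v
      · subst hwv
        rw [frameIn_cons_self, frameIn_cons_self]
        exact key
      · rw [frameIn_cons_of_ne U' hwv, frameIn_cons_of_ne U hwv]
        exact ih2 w (List.mem_of_ne_of_mem hwv hw)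
    · -- frame supports
      rw [frameSupp_cons, frameSupp_cons, frameIn_cons_self, frameIn_cons_self, ← hS'def, key]
      refine Set.union_subset_union ih3 fun f hf => ?_
      exact mem_coe.2 (mem_of_mem_erase (esupp_secAt_subset (isUpperSet_hull (hU v) _) e b (mem_coe.1 hf)))
    · rw [frameSupp_cons, frameIn_cons_self, ← hS'def, key, Set.mem_union, not_or]
      exact ⟨ih4, fun h => not_affects_secAt e b _ (mem_esupp.1 (mem_coe.1 h))⟩

/-! ### Consequences -/

/-- **Good chains restrict to faces**: a good chain of `U` is a good chain of the sectioned family `k ↦ (U k)^{e←b}`, in the same order, as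
soon as the sections are non-empty. [this work] -/
theorem goodChain_secAt (hU : ∀ k, IsUpperSet (U k)) (hne : ∀ k, (secAt e b (U k)).Nonempty) {l : List κ} (hl : GoodChain U l) :
    GoodChain (fun k => secAt e b (U k)) l :=
  (goodChain_secAt_aux U e b hU hne l.length le_rfl hl).1

/-- **Frames commute with sections**: along a good chain, the frame of a member in the sectioned family is the section of its frame. [this work] -/
theorem frameIn_secAt (hU : ∀ k, IsUpperSet (U k)) (hne : ∀ k, (secAt e b (U k)).Nonempty) {l : List κ} (hl : GoodChain U l)
    {w : κ} (hw : w ∈ l) : frameIn (fun k => secAt e b (U k)) l w = secAt e b (frameIn U l w) :=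
  (goodChain_secAt_aux U e b hU hne l.length le_rfl hl).2.1 w hw

/-- The frame support of the sectioned chain lies inside the original one and misses `e`. [this work] -/
theorem frameSupp_secAt_subset (hU : ∀ k, IsUpperSet (U k)) (hne : ∀ k, (secAt e b (U k)).Nonempty) {l : List κ} (hl : GoodChain U l) :
    frameSupp (fun k => secAt e b (U k)) l ⊆ frameSupp U l ∧ e ∉ frameSupp (fun k => secAt e b (U k)) l :=
  (goodChain_secAt_aux U e b hU hne l.length le_rfl hl).2.2

/-- **Structured families restrict to faces** (with non-empty sections). [this work] -/
theorem structured_secAt (hU : ∀ k, IsUpperSet (U k)) (hne : ∀ k, (secAt e b (U k)).Nonempty) {W : Finset κ}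
    (hW : Structured U W) : Structured (fun k => secAt e b (U k)) W := by
  obtain ⟨l, hlW, hl⟩ := hW
  exact ⟨l, hlW, goodChain_secAt U e b hU hne hl⟩

/-- **Canonical frames commute with sections**: for a structured family with non-empty sections, the canonical frame of each member in the
sectioned family is the section of its canonical frame. [this work] -/
theorem cframe_secAt (hU : ∀ k, IsUpperSet (U k)) (hne : ∀ k, (secAt e b (U k)).Nonempty) {W : Finset κ} (hW : Structured U W)
    {w : κ} (hw : w ∈ W) : cframe (fun k => secAt e b (U k)) W w = secAt e b (cframe U W w) := by
  have hneU : ∀ k, (U k).Nonempty := by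
    intro k
    obtain ⟨ω, hω⟩ := hne k
    exact ⟨forceAt e b ω, (mem_secAt).1 hω⟩
  have hU' : ∀ k, IsUpperSet (secAt e b (U k)) := fun k => isUpperSet_secAt e b (hU k)
  obtain ⟨l, hlW, hl⟩ := hW
  subst hlW
  have hwl : w ∈ l := List.mem_toFinset.1 hw
  rw [← frameIn_eq_cframe U hU hneU hl hwl, ← frameIn_eq_cframe _ hU' hne (goodChain_secAt U e b hU hne hl) hwl]
  exact frameIn_secAt U e b hU hne hl hwl

/-- The annihilator of a member in the sectioned chain is the section of its annihilator. [this work] -/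
theorem frameIn_diff_secAt (hU : ∀ k, IsUpperSet (U k)) (hne : ∀ k, (secAt e b (U k)).Nonempty) {l : List κ} (hl : GoodChain U l)
    {w : κ} (hw : w ∈ l) :
    frameIn (fun k => secAt e b (U k)) l w \ secAt e b (U w) = secAt e b (frameIn U l w \ U w) := by
  rw [frameIn_secAt U e b hU hne hl hw]
  ext ω
  simp only [Set.mem_sdiff, mem_secAt]

/-! ### Pure faces: a chain whose `e ← false` face is pairwise independent has at most one member depending on `e` -/

/-- Along any list, a family of increasing events with pairwise disjoint essential supports has frames equal to its members and frame support
the union of the members' supports. [this work] -/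
theorem frameIn_eq_self_of_pairwise_disjoint (hU : ∀ k, IsUpperSet (U k)) :
    ∀ {l : List κ}, l.Nodup → (∀ w ∈ l, ∀ w' ∈ l, w ≠ w' → Disjoint (esupp (U w)) (esupp (U w'))) →
      (∀ w ∈ l, frameIn U l w = U w) ∧ frameSupp U l = ⋃ w ∈ l.toFinset, (↑(esupp (U w)) : Set ι)
  | [], _, _ => by simp [frameSupp]
  | v :: l, hn, hd => by
    have hv : v ∉ l := (List.nodup_cons.1 hn).1
    obtain ⟨ih1, ih2⟩ := frameIn_eq_self_of_pairwise_disjoint hU (List.nodup_cons.1 hn).2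
      (fun w hw w' hw' hne => hd w (List.mem_cons_of_mem v hw) w' (List.mem_cons_of_mem v hw') hne)
    have hdis : Disjoint (frameSupp U l) ↑(esupp (U v)) := by
      rw [ih2, Set.disjoint_iUnion₂_left]
      intro w hw
      have hwl : w ∈ l := List.mem_toFinset.1 hw
      exact disjoint_coe.2 (hd w (List.mem_cons_of_mem v hwl) v List.mem_cons_self fun h => hv (h ▸ hwl))
    have hhead : frameIn U (v :: l) v = U v := by
      rw [frameIn_cons_self]; exact hull_eq_self_of_disjoint (hU v) hdis
    refine ⟨fun w hw => ?_, ?_⟩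
    · by_cases hwv : w = v
      · subst hwv; exact hhead
      · rw [frameIn_cons_of_ne U hwv]; exact ih1 w (List.mem_of_ne_of_mem hwv hw)
    · rw [frameSupp_cons, hhead, ih2, List.toFinset_cons, set_biUnion_insert, Set.union_comm]

/-- **Lemma PF1 (pure faces).**  Let `l` be a good chain of increasing events whose `e ← false` sections are non-empty and PAIRWISE INDEPENDENT
(disjoint essential supports).  Then every member whose frame does not depend on `e` IS its frame (pure): `frameIn U l w = U w`.
(TIGHTNESS.md §4.5; proof: frames commute with sections, the sectioned chain is a pure frame, and an `e`-free frame with the same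
`e ← false` section as its member equals it.) [this work] -/
theorem frameIn_eq_self_of_secAt_pairwise_disjoint (hU : ∀ k, IsUpperSet (U k)) (hne : ∀ k, (secAt e false (U k)).Nonempty)
    {l : List κ} (hl : GoodChain U l)
    (hind : ∀ w ∈ l, ∀ w' ∈ l, w ≠ w' → Disjoint (esupp (secAt e false (U w))) (esupp (secAt e false (U w'))))
    {w : κ} (hw : w ∈ l) (hew : e ∉ esupp (frameIn U l w)) : frameIn U l w = U w := by
  set U' : κ → Set (Set ι) := fun k => secAt e false (U k) with hU'def
  have hU' : ∀ k, IsUpperSet (U' k) := fun k => isUpperSet_secAt e false (hU k)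
  have hl' : GoodChain U' l := goodChain_secAt U e false hU hne hl
  have hpure : frameIn U' l w = U' w :=
    (frameIn_eq_self_of_pairwise_disjoint U' hU' (GoodChain.nodup U' hl') hind).1 w hw
  have hcomm : frameIn U' l w = secAt e false (frameIn U l w) := frameIn_secAt U e false hU hne hl hw
  -- the frame is `e`-free, so it equals its own `e ← false` section, which is the section of the member
  have hAfree : secAt e false (frameIn U l w) = frameIn U l w :=
    secAt_eq_self_of_not_affects (isUpperSet_frameIn U hU l w) (fun h => hew (mem_esupp.2 h)) false
  refine Set.Subset.antisymm (fun φ hφ => ?_) (subset_frameIn U hU l w)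
  have h1 : φ ∈ U' w := by
    rw [← hpure, hcomm, hAfree]
    exact hφ
  have h2 : forceAt e false φ ∈ U w := (mem_secAt).1 h1
  -- `φ ∖ {e} ∈ U w`, and `U w` is increasing
  exact hU w (fun x hx => hx.1 : φ \ {e} ⊆ φ) h2

/-- **At most one member of such a chain depends on `e`** (the one whose frame's block contains `e`). [this work] -/
theorem card_filter_affects_le_one_of_secAt_pairwise_disjoint (hU : ∀ k, IsUpperSet (U k)) (hne : ∀ k, (secAt e false (U k)).Nonempty)
    {l : List κ} (hl : GoodChain U l)
    (hind : ∀ w ∈ l, ∀ w' ∈ l, w ≠ w' → Disjoint (esupp (secAt e false (U w))) (esupp (secAt e false (U w')))) :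
    (l.toFinset.filter fun w => Affects (U w) e).card ≤ 1 := by
  refine card_le_one.2 fun a ha b' hb' => ?_
  rw [mem_filter, List.mem_toFinset] at ha hb'
  by_contra hab
  -- both frames must depend on `e`, contradicting the disjointness of the frames' supports
  have hea : e ∈ esupp (frameIn U l a) := by
    by_contra h
    have hfa := frameIn_eq_self_of_secAt_pairwise_disjoint U e hU hne hl hind ha.1 h
    rw [hfa] at h
    exact h (mem_esupp.2 ha.2)
  have heb : e ∈ esupp (frameIn U l b') := by
    by_contra h
    have hfb := frameIn_eq_self_of_secAt_pairwise_disjoint U e hU hne hl hind hb'.1 h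
    rw [hfb] at h
    exact h (mem_esupp.2 hb'.2)
  exact Finset.disjoint_left.1 (disjoint_esupp_frameIn U (GoodChain.nodup U hl) ha.1 hb'.1 hab) hea heb

end Summit.CriticalPhenomena.PercolationContinuityZ3.Theorems
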